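import Summits.BirchSwinnertonDyer.BirchSwinnertonDyer.Theorems.PrintCf2SplitBadTwoUnrLocalLift
import Literature.NumberTheory.EllipticCurves.H1TrivialAction
import Literature.NumberTheory.EllipticCurves.SubgroupSelmerCocycleCriteriaProofs
import HarnessLib

/-!
# Crux `PrintCf2.SplitBadTwoRankOneOfFacts` (stmt-BirchSwinnertonDyer-20368), road α v13.1, stub S3d class (iii):
# THE LOCAL DEFECT GROUP `𝓛` AT `v̄` — `conj_δ − 1` IS ONTO `𝓛` (the hypothesis h𝓛 of the unramified base lift), ENGINE

Cell `bsd-print-cf2`, EXTRA WIDTH seat `bsd-line-cf2-p1-w4` gen 11 (`--supports stmt-BirchSwinnertonDyer-20368`; closes nothing; no summit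
statement is proved here). Files `…UnrLocalLift` / `…UnrBaseLift` / `…UnrCoinvariantsFrame` (this seat, p691301 / p692148 / p692596) prove
`#(S_nr)_Γ = 1` on every road-α frame MODULO ONE displayed local hypothesis h𝓛: for `δ ∈ D_v̄ ∖ ker κ'` the map `conj_δ − 1` is onto
`𝓛 := ker (H¹(D″, W*) → H¹(ker κ' ∩ I_v̄, W*))`, `D″ := D_v̄ ∩ ker κ'`. This file is the ENGINE discharging h𝓛 from four inputs
(`localDefect_conj_sub_surjective_of_character`, §3): (1) `D″` acts trivially on `M`; (2) `M` is `p`-primary; (3) a continuous character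
`χ : D_v̄ → ℤ_p` killing `I_v̄ ∩ ker κ'` and non-trivial on `D″` (on the frame: the PARTNER line, unramified at `v̄`); (4) a topological
generator `γ` of `D″` modulo `I″ := I_v̄ ∩ ker κ'` (the tree's `AnomalousLocalTorsion.exists_generator_decomp_inf_kerSubgroup`); (5) for
`δ ∈ D_v̄ ∖ ker κ'`, `δ − 1` is onto `M`. The frame instance (class (iii), `d ≡ 3 (8)`) is the sequel file `…UnrLocalDefectFrame`.

## The argument (§2, any topological group `G`, normal subgroup `N` acting trivially on the discrete `p`-primary `M`)

Classes on `N` are continuous homomorphisms (`Literature.…H1TrivialAction`). Normalise `χ|_N` to an additive continuous `s : N → ℤ_p` with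
`s(γ) = 1`, `s|_S = 0` (`S` = the inertial elements), `s` constant on `χ`-fibres (`exists_normalised_additiveChar`: `χ(N) = p^a ℤ_p u`-free
part read through `ProcyclicDescent.rescale`; `χ γ ≠ 1` because an open subgroup `{p^b ∣ χ}` containing `S` and `γ` is all of `N`). For
`p^k m = 0` the map `f_{k,m} : h ↦ (s(h) mod p^k)·m` is a continuous homomorphism killing `S` (`exists_cocycle_appr_nsmul`). KEY FACTS:
(a) every class `φ` killing `S` is `f_{k,φ(γ)}` — the equaliser `{φ = f}` is an open subgroup containing `S` and `γ`; (b)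
`conj_δ f_{k,m} = f_{k,δm}` (`s(δ⁻¹hδ) = s(h)`); hence `conj_δ f_{k,m'} − f_{k,m'} = f_{k,δm'−m'} = f_{k,φ(γ)} = φ` once `δm' − m' = φ(γ)`
(`exists_conjH1_sub_eq_of_additiveChar`). §3 puts this in the tree's `Coinv.kerD` currency: `ρ a = 0 ↔` the cocycle of `a` kills the
inertial elements (`CocycleCriteria.resH1Hom_oneCocycleClass_eq_zero_iff` + triviality of the `D″`-action), and transports the generator
from `↥(D_v̄ ⊓ ker κ')` to `↥(Coinv.kerD κ' v̄)`.

Search: presearch «H^1 of unramified quotient with trivial action, Frobenius evaluation, (Frob−1) surjective on divisible module» →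
[corpus: GreenbergLNM1716 §2 pp. 70–73 (H¹(K_v^{nr}/K_v, A) = A/(Frob−1)A)] [corpus: Rubin1999 Lemma 3.6] — the evaluation-at-Frobenius
isomorphism; no new Literature fact needed. [cite: GreenbergLNM1716, §2 Prop. 2.4 (p. 73)] [cite: SerreGaloisCohomology1997, I §2.3, §2.5]
[cite: NeukirchSchmidtWingberg2008, (1.6.2), (7.1.2)] beyond-print theorem: no. BSD is not proved by any of this.
-/

noncomputable section

open scoped Classical

set_option linter.dupNamespace false
set_option autoImplicit false

open NumberField IsDedekindDomain Field
open Literature.NumberTheory.EllipticCurves Literature.NumberTheory.EllipticCurves.GreenbergSelmer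
open Literature.NumberTheory.GaloisRepresentations
open Summit.BirchSwinnertonDyer.Rank1Residual.X11b

namespace Summit.BirchSwinnertonDyer.BirchSwinnertonDyer.Theorems.PrintCf2.UnrBaseLift

/-! ## §1. Arithmetic: `(x mod p^k) • m` on `p^k`-torsion -/

section Arith

variable {M : Type} [AddCommGroup M] {p : ℕ}

/-- Natural multiples congruent modulo `p^k` agree on an element killed by `p^k`. [folklore] -/
theorem nsmul_eq_nsmul_of_modEq {k : ℕ} {m : M} (hm : p ^ k • m = 0) {a b : ℕ} (h : a ≡ b [MOD p ^ k]) :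
    a • m = b • m := by
  have key : ∀ c : ℕ, c • m = (c % p ^ k) • m := fun c ↦ by
    conv_lhs => rw [← Nat.mod_add_div c (p ^ k)]
    rw [add_smul, mul_comm, mul_smul, hm, smul_zero, add_zero]
  rw [key a, key b, show a % p ^ k = b % p ^ k from h]

variable [Fact p.Prime]

/-- `toZModPow k x` is the residue of `x.appr k`. [folklore] -/
theorem toZModPow_eq_natCast_appr (k : ℕ) (x : ℤ_[p]) :
    PadicInt.toZModPow k x = ((x.appr k : ℕ) : ZMod (p ^ k)) :=
  rfl

/-- `((x + y) mod p^k) • m = (x mod p^k) • m + (y mod p^k) • m` on `p^k`-torsion. [folklore] -/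
theorem appr_add_nsmul {k : ℕ} {m : M} (hm : p ^ k • m = 0) (x y : ℤ_[p]) :
    (x + y).appr k • m = x.appr k • m + y.appr k • m := by
  have h := map_add (PadicInt.toZModPow (p := p) k) x y
  rw [toZModPow_eq_natCast_appr, toZModPow_eq_natCast_appr, toZModPow_eq_natCast_appr, ← Nat.cast_add,
    ZMod.natCast_eq_natCast_iff] at h
  rw [nsmul_eq_nsmul_of_modEq hm h, add_smul]

/-- `(1 mod p^k) • m = m` on `p^k`-torsion. [folklore] -/
theorem appr_one_nsmul {k : ℕ} {m : M} (hm : p ^ k • m = 0) : (1 : ℤ_[p]).appr k • m = m := by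
  have h : (((1 : ℤ_[p]).appr k : ℕ) : ZMod (p ^ k)) = ((1 : ℕ) : ZMod (p ^ k)) := by
    rw [Nat.cast_one, ← toZModPow_eq_natCast_appr, map_one]
  rw [ZMod.natCast_eq_natCast_iff] at h
  rw [nsmul_eq_nsmul_of_modEq hm h, one_smul]

/-- `(x mod p^k) • m = 0` on `p^k`-torsion when `x ∈ p^k ℤ_p` (in particular for `x = 0`). [folklore] -/
theorem appr_nsmul_eq_zero_of_mem_span {k : ℕ} {m : M} (hm : p ^ k • m = 0) {x : ℤ_[p]}
    (hx : x ∈ (Ideal.span {(p : ℤ_[p]) ^ k} : Ideal ℤ_[p])) : x.appr k • m = 0 := by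
  have h : PadicInt.toZModPow k x = 0 := by
    rw [← RingHom.mem_ker, PadicInt.ker_toZModPow]; exact hx
  rw [toZModPow_eq_natCast_appr, ← Nat.cast_zero, ZMod.natCast_eq_natCast_iff] at h
  rw [nsmul_eq_nsmul_of_modEq hm h, zero_smul]

/-- `(0 mod p^k) • m = 0`. [folklore] -/
theorem appr_zero_nsmul {k : ℕ} {m : M} (hm : p ^ k • m = 0) : (0 : ℤ_[p]).appr k • m = 0 :=
  appr_nsmul_eq_zero_of_mem_span hm (Ideal.zero_mem _)

/-- `(x mod p^{k'}) • m = (x mod p^k) • m` for `k ≤ k'` on `p^k`-torsion. [folklore] -/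
theorem appr_nsmul_eq_of_le {k k' : ℕ} (hk : k ≤ k') {m : M} (hm : p ^ k • m = 0) (x : ℤ_[p]) :
    x.appr k' • m = x.appr k • m :=
  (nsmul_eq_nsmul_of_modEq hm
    ((Nat.modEq_iff_dvd' (PadicInt.appr_mono x hk)).mpr (PadicInt.dvd_appr_sub_appr x k k' hk))).symm

/-- An element of `ℤ_p` divisible by every power of `p` is `0`. [folklore] -/
theorem eq_zero_of_forall_pow_dvd {x : ℤ_[p]} (h : ∀ a : ℕ, (p : ℤ_[p]) ^ a ∣ x) : x = 0 := by
  by_contra hx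
  have hpos : 0 < ‖x‖ := norm_pos_iff.mpr hx
  have hp1 : ((p : ℝ))⁻¹ < 1 := inv_lt_one_of_one_lt₀ (by exact_mod_cast (Fact.out : p.Prime).one_lt)
  obtain ⟨a, ha⟩ := exists_pow_lt_of_lt_one hpos hp1
  have hle : ‖x‖ ≤ (p : ℝ) ^ (-(a : ℤ)) :=
    (PadicInt.norm_le_pow_iff_mem_span_pow x a).mpr (Ideal.mem_span_singleton.mpr (h a))
  rw [zpow_neg, zpow_natCast, ← inv_pow] at hle
  exact absurd (lt_of_le_of_lt hle ha) (lt_irrefl _)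

end Arith

/-! ## §2. The engine on a normal subgroup acting trivially -/

section Engine

variable {G : Type} [Group G] [TopologicalSpace G] [IsTopologicalGroup G]
  {M : Type} [AddCommGroup M] [DistribMulAction G M] [TopologicalSpace M] [DiscreteTopology M]
  {p : ℕ} [Fact p.Prime] (N : Subgroup G)

omit [IsTopologicalGroup G] in
/-- **Divisibility propagates from `S ∪ {γ}` to `N`**: if `χ : N → ℤ_p` kills `S` and `p^a ∣ χ(γ)`, and every open subgroup of `N`
containing `S` and `γ` is `N`, then `p^a ∣ χ(g)` for all `g ∈ N` (the set `{p^a ∣ χ}` is an open subgroup). [cite: Washington1997, §13.1] -/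
theorem forall_pow_dvd_toAdd_of_generator (χ : N →ₜ* Multiplicative ℤ_[p]) (S : Set N) (hS : ∀ x ∈ S, χ x = 1)
    (γ : N) {a : ℕ} (hγ : (p : ℤ_[p]) ^ a ∣ (χ γ).toAdd)
    (hgen : ∀ U : Subgroup N, IsOpen (U : Set N) → S ⊆ U → γ ∈ U → U = ⊤) (g : N) :
    (p : ℤ_[p]) ^ a ∣ (χ g).toAdd := by
  let U : Subgroup N :=
    { carrier := {g | (p : ℤ_[p]) ^ a ∣ (χ g).toAdd}
      mul_mem' := fun {x y} hx hy ↦ by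
        change (p : ℤ_[p]) ^ a ∣ (χ (x * y)).toAdd
        rw [map_mul, toAdd_mul]; exact dvd_add hx hy
      one_mem' := by
        change (p : ℤ_[p]) ^ a ∣ (χ 1).toAdd
        rw [map_one, toAdd_one]; exact dvd_zero _
      inv_mem' := fun {x} hx ↦ by
        change (p : ℤ_[p]) ^ a ∣ (χ x⁻¹).toAdd
        rw [map_inv, toAdd_inv]; exact (dvd_neg).mpr hx }
  have hopen : IsOpen (U : Set N) := by
    have e : (U : Set N) = {g | ‖(χ g).toAdd‖ < (p : ℝ) ^ (-(a : ℤ) + 1)} := by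
      ext g
      change (p : ℤ_[p]) ^ a ∣ (χ g).toAdd ↔ ‖(χ g).toAdd‖ < (p : ℝ) ^ (-(a : ℤ) + 1)
      rw [← Ideal.mem_span_singleton, ← PadicInt.norm_le_pow_iff_mem_span_pow,
        PadicInt.norm_le_pow_iff_norm_lt_pow_add_one]
    rw [e]
    exact isOpen_lt (continuous_norm.comp (continuous_toAdd.comp χ.continuous)) continuous_const
  have hSU : S ⊆ U := fun x hx ↦ by
    change (p : ℤ_[p]) ^ a ∣ (χ x).toAdd
    rw [hS x hx, toAdd_one]; exact dvd_zero _
  have htop := hgen U hopen hSU hγ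
  have hg : g ∈ U := by rw [htop]; exact Subgroup.mem_top g
  exact hg

omit [IsTopologicalGroup G] in
/-- **The normalised additive character.** For `N` compact, `χ : N → ℤ_p` continuous killing `S`, non-trivial on `N`, and `γ` a
topological generator of `N` modulo `S` (every open subgroup containing `S` and `γ` is `N`): there is a continuous additive
`s : N → ℤ_p` with `s|_S = 0`, `s(γ) = 1`, constant on the fibres of `χ` — namely `s = u⁻¹ p^{-a} χ` where `χ(γ) = p^a u`
(`χ(γ) ≠ 0` since otherwise `χ` would be divisible by every `p^b`, i.e. trivial). [cite: Washington1997, §13.1]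
[cite: NeukirchANT1999, Ch. I §9 Prop. (9.4)] -/
theorem exists_normalised_additiveChar [CompactSpace N] (χ : N →ₜ* Multiplicative ℤ_[p]) (S : Set N)
    (hS : ∀ x ∈ S, χ x = 1) (γ : N) (hex : ∃ d : N, χ d ≠ 1)
    (hgen : ∀ U : Subgroup N, IsOpen (U : Set N) → S ⊆ U → γ ∈ U → U = ⊤) :
    ∃ s : N → ℤ_[p], Continuous s ∧ (∀ a b, s (a * b) = s a + s b) ∧ (∀ x ∈ S, s x = 0) ∧ s γ = 1 ∧
      ∀ x y, χ x = χ y → s x = s y := by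
  -- `χ γ ≠ 1`
  have hγ0 : (χ γ).toAdd ≠ 0 := by
    intro h0
    obtain ⟨d, hd⟩ := hex
    apply hd
    have hall : ∀ a : ℕ, (p : ℤ_[p]) ^ a ∣ (χ d).toAdd := fun a ↦
      forall_pow_dvd_toAdd_of_generator N χ S hS γ (a := a) (by rw [h0]; exact dvd_zero _) hgen d
    rw [← ofAdd_toAdd (χ d), eq_zero_of_forall_pow_dvd hall, ofAdd_zero]
  have hspec := PadicInt.unitCoeff_spec hγ0
  have hdiv : ∀ g : N, (p : ℤ_[p]) ^ ((χ γ).toAdd).valuation ∣ (χ g).toAdd :=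
    forall_pow_dvd_toAdd_of_generator N χ S hS γ (Dvd.intro_left _ hspec.symm) hgen
  refine ⟨fun g ↦ (ProcyclicDescent.rescale χ _ hdiv g).toAdd * ↑(PadicInt.unitCoeff hγ0)⁻¹, ?_, ?_, ?_, ?_, ?_⟩
  · exact Continuous.mul (continuous_toAdd.comp (ProcyclicDescent.rescale χ _ hdiv).continuous) continuous_const
  · intro x y
    simp only [map_mul, toAdd_mul, add_mul]
  · intro x hx
    have h0 : (χ x).toAdd = (p : ℤ_[p]) ^ ((χ γ).toAdd).valuation * 0 := by rw [hS x hx, toAdd_one, mul_zero]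
    change (ProcyclicDescent.rescale χ _ hdiv x).toAdd * _ = 0
    rw [ProcyclicDescent.rescale_eq_of_eq χ _ hdiv x 0 h0, toAdd_ofAdd, zero_mul]
  · have h1 : (χ γ).toAdd = (p : ℤ_[p]) ^ ((χ γ).toAdd).valuation * ↑(PadicInt.unitCoeff hγ0) :=
      hspec.trans (mul_comm _ _)
    change (ProcyclicDescent.rescale χ _ hdiv γ).toAdd * _ = 1
    rw [ProcyclicDescent.rescale_eq_of_eq χ _ hdiv γ _ h1, toAdd_ofAdd, Units.mul_inv]
  · intro x y hxy
    change (ProcyclicDescent.rescale χ _ hdiv x).toAdd * _ = (ProcyclicDescent.rescale χ _ hdiv y).toAdd * _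
    obtain ⟨c, hc⟩ := hdiv x
    have hc' : (χ y).toAdd = (p : ℤ_[p]) ^ ((χ γ).toAdd).valuation * c := by rw [← hxy]; exact hc
    rw [ProcyclicDescent.rescale_eq_of_eq χ _ hdiv x c hc, ProcyclicDescent.rescale_eq_of_eq χ _ hdiv y c hc']

/-- **The cocycles `f_{k,m} : h ↦ (s(h) mod p^k)·m`.** For `N` acting trivially on `M`, `s : N → ℤ_p` continuous additive and `p^k m = 0`,
`h ↦ (s h).appr k • m` is a continuous homomorphism, i.e. a cocycle (`homCocycle`); it is continuous because it vanishes on the open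
neighbourhood `{‖s‖ < p^{-k}}` of `1`. [cite: SerreGaloisCohomology1997, I §2.3] -/
theorem exists_cocycle_appr_nsmul (htriv : ∀ (n : N) (m : M), n • m = m) {s : N → ℤ_[p]} (hs : Continuous s)
    (hadd : ∀ a b, s (a * b) = s a + s b) {k : ℕ} {m : M} (hm : p ^ k • m = 0) :
    ∃ f : contOneCocycles (discreteTopRep N M), ∀ h : N, f.1 h = (s h).appr k • m := by
  have hadd' : ∀ a b : N, (s (a * b)).appr k • m = (s a).appr k • m + (s b).appr k • m := fun a b ↦ by
    rw [hadd, appr_add_nsmul hm]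
  have hcont : Continuous fun h : N ↦ (s h).appr k • m := by
    refine continuous_of_map_mul_of_forall_mem_eq_zero hadd' {h : N | ‖s h‖ < (p : ℝ) ^ (-(k : ℤ))}
      (isOpen_lt (continuous_norm.comp hs) continuous_const) ?_ fun h hh ↦ ?_
    · change ‖s 1‖ < (p : ℝ) ^ (-(k : ℤ))
      rw [map_one_eq_zero_of_map_mul hadd, norm_zero]
      exact zpow_pos (by exact_mod_cast (Fact.out : p.Prime).pos) _
    · exact appr_nsmul_eq_zero_of_mem_span hm ((PadicInt.norm_le_pow_iff_mem_span_pow _ _).mp (le_of_lt hh))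
  exact ⟨homCocycle htriv _ hadd' hcont, fun h ↦ rfl⟩

variable [N.Normal]

/-- **THE ENGINE: `conj_δ − 1` is onto the classes killing `S`.** `N ⊴ G` acting trivially on the discrete `p`-primary `M`;
`s : N → ℤ_p` continuous additive with `s|_S = 0`, `s(γ) = 1`, invariant under `h ↦ δ⁻¹hδ`; every open subgroup of `N` containing
`S` and `γ` is `N`; `δ − 1` onto `M`. Then every class `a ∈ H¹(N, M)` whose cocycle kills `S` is `conj_δ ℓ − ℓ` for a class `ℓ`
whose cocycle kills `S`: `a = f_{k,a(γ)}` (equaliser argument), `a(γ) = δm' − m'`, `ℓ := f_{k',m'}`, and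
`conj_δ f_{k',m'} − f_{k',m'} = f_{k',δm'−m'}`. This is the `H¹(K_v^{nr}/K_v, A) = A/(Frob − 1)A` computation of Greenberg, with the
extra `Γ`-equivariance. [cite: GreenbergLNM1716, §2 Prop. 2.4 (p. 73)] [cite: SerreGaloisCohomology1997, I §2.5] -/
theorem exists_conjH1_sub_eq_of_additiveChar (htriv : ∀ (n : N) (m : M), n • m = m)
    (htor : ∀ m : M, ∃ k : ℕ, p ^ k • m = 0) {s : N → ℤ_[p]} (hs : Continuous s)
    (hadd : ∀ a b, s (a * b) = s a + s b) (S : Set N) (hS : ∀ x ∈ S, s x = 0) (γ : N) (hγ : s γ = 1)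
    (hgen : ∀ U : Subgroup N, IsOpen (U : Set N) → S ⊆ U → γ ∈ U → U = ⊤) (δ : G)
    (hsδ : ∀ n : N, s (subgroupConj N δ n) = s n) (hδ : ∀ m : M, ∃ m' : M, δ • m' - m' = m)
    (a : subgroupH1 N M) (ha : ∀ x ∈ S, (cocycleOf N M htriv a).1 x = 0) :
    ∃ ℓ : subgroupH1 N M, (∀ x ∈ S, (cocycleOf N M htriv ℓ).1 x = 0) ∧ conjH1 N M δ ℓ - ℓ = a := by
  set φ := cocycleOf N M htriv a with hφdef
  obtain ⟨k₀, hk₀⟩ := htor (φ.1 γ)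
  obtain ⟨f₀, hf₀⟩ := exists_cocycle_appr_nsmul N htriv hs hadd hk₀
  -- (a) `φ = f_{k₀, φ(γ)}`: the equaliser is an open subgroup containing `S` and `γ`
  have hφf : φ = f₀ := by
    let U : Subgroup N :=
      { carrier := {h | φ.1 h = f₀.1 h}
        mul_mem' := fun {x y} hx hy ↦ by
          change φ.1 x = f₀.1 x at hx
          change φ.1 y = f₀.1 y at hy
          change φ.1 (x * y) = f₀.1 (x * y)
          rw [cocycle_map_mul_of_trivial htriv φ, cocycle_map_mul_of_trivial htriv f₀, hx, hy]
        one_mem' := by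
          change φ.1 1 = f₀.1 1
          rw [map_one_eq_zero_of_map_mul (cocycle_map_mul_of_trivial htriv φ),
            map_one_eq_zero_of_map_mul (cocycle_map_mul_of_trivial htriv f₀)]
        inv_mem' := fun {x} hx ↦ by
          change φ.1 x = f₀.1 x at hx
          change φ.1 x⁻¹ = f₀.1 x⁻¹
          rw [cocycle_map_inv_of_trivial htriv φ, cocycle_map_inv_of_trivial htriv f₀, hx] }
    have hopen : IsOpen (U : Set N) := by
      refine isOpen_iff_forall_mem_open.mpr fun h₀ hh₀ ↦
        ⟨φ.1 ⁻¹' {φ.1 h₀} ∩ f₀.1 ⁻¹' {f₀.1 h₀}, ?_, ?_, ⟨rfl, rfl⟩⟩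
      · rintro h ⟨h1, h2⟩
        rw [Set.mem_preimage, Set.mem_singleton_iff] at h1 h2
        change φ.1 h = f₀.1 h
        rw [h1, h2]; exact hh₀
      · exact ((isOpen_discrete _).preimage φ.1.continuous).inter ((isOpen_discrete _).preimage f₀.1.continuous)
    have hSU : S ⊆ U := fun x hx ↦ by
      change φ.1 x = f₀.1 x
      rw [ha x hx, hf₀, hS x hx, appr_zero_nsmul hk₀]
    have hγU : γ ∈ U := by
      change φ.1 γ = f₀.1 γ
      rw [hf₀, hγ, appr_one_nsmul hk₀]
    have htop := hgen U hopen hSU hγU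
    apply Subtype.ext
    ext h
    have hh : h ∈ U := by rw [htop]; exact Subgroup.mem_top h
    exact hh
  -- (b) `m'` with `δ m' − m' = φ(γ)`, and a common exponent `k' = k₀ + k₁`
  obtain ⟨m', hm'⟩ := hδ (φ.1 γ)
  obtain ⟨k₁, hk₁⟩ := htor m'
  have hk'm' : p ^ (k₀ + k₁) • m' = 0 := by rw [pow_add, mul_smul, hk₁, smul_zero]
  obtain ⟨fℓ, hfℓ⟩ := exists_cocycle_appr_nsmul N htriv hs hadd hk'm'
  refine ⟨oneCocycleClass _ fℓ, fun x hx ↦ ?_, ?_⟩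
  · rw [cocycleOf_oneCocycleClass, hfℓ, hS x hx, appr_zero_nsmul hk'm']
  · rw [← oneCocycleClass_cocycleOf htriv a, conjH1_oneCocycleClass, ← oneCocycleClass_sub, ← hφdef, hφf]
    congr 1
    apply Subtype.ext
    ext h
    rw [sub_apply_val, conjCocycle_apply, hfℓ, hfℓ, hf₀, hsδ, smul_comm δ ((s h).appr (k₀ + k₁)) m', ← smul_sub, hm',
      appr_nsmul_eq_of_le (Nat.le_add_right k₀ k₁) hk₀]

end Engine

/-! ## §3. The number-field currency: h𝓛 from a character, a generator and `δ − 1` onto `M` -/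

section Local

variable {K : Type} [Field K] [NumberField K] {p : ℕ} [Fact p.Prime] (κ : ZpExtension K p)
  (M : Type) [AddCommGroup M] [DistribMulAction (absoluteGaloisGroup K) M] [TopologicalSpace M]
  [DiscreteTopology M] (𝔮 : HeightOneSpectrum (𝓞 K))

/-- **h𝓛 FROM LOCAL STRUCTURE.** Let `D″ := D_𝔮 ∩ ker κ` act trivially on the discrete `p`-primary `M`; let `χ : D_𝔮 → ℤ_p` be a
continuous character killing `I_𝔮 ∩ ker κ` and non-trivial on `D″`; let `D″` have a topological generator modulo `I_𝔮 ∩ ker κ`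
(`AnomalousLocalTorsion.exists_generator_decomp_inf_kerSubgroup`); and let `δ − 1` be onto `M` for every `δ ∈ D_𝔮 ∖ ker κ`. Then
h𝓛 holds: for `δ ∈ D_𝔮 ∖ ker κ`, `conj_δ − 1` maps the local defect group
`𝓛 = ker (H¹(D″, M) → H¹(ker κ ∩ I_𝔮, M))` (in the `Coinv.kerD` currency of `…UnrLocalLift`) ONTO itself — §2's engine with
`N = Coinv.kerD κ 𝔮`, `S` = the inertial elements, `s` = the normalised `χ|_N`.
[cite: GreenbergLNM1716, §2 Prop. 2.4 (p. 73)] [cite: JetchevSkinnerWan2017, Lemma 3.3.3 (arXiv:1512.06894 p. 12)] -/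
theorem localDefect_conj_sub_surjective_of_character
    (hD : ∀ g : absoluteGaloisGroup K, g ∈ decomp 𝔮 → g ∈ κ.kerSubgroup → ∀ m : M, g • m = m)
    (htor : ∀ m : M, ∃ k : ℕ, p ^ k • m = 0)
    (χ : ↥(decomp (K := K) 𝔮) →ₜ* Multiplicative ℤ_[p])
    (hχI : ∀ g : ↥(decomp (K := K) 𝔮), (g : absoluteGaloisGroup K) ∈ inertia 𝔮 →
      (g : absoluteGaloisGroup K) ∈ κ.kerSubgroup → χ g = 1)
    (hχD : ∃ g : ↥(decomp (K := K) 𝔮), (g : absoluteGaloisGroup K) ∈ κ.kerSubgroup ∧ χ g ≠ 1)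
    (hγ : ∃ γ : ↥(decomp 𝔮 ⊓ κ.kerSubgroup), ∀ U : Subgroup ↥(decomp 𝔮 ⊓ κ.kerSubgroup),
      IsOpen (U : Set ↥(decomp 𝔮 ⊓ κ.kerSubgroup)) →
        (inertia 𝔮).subgroupOf (decomp 𝔮 ⊓ κ.kerSubgroup) ≤ U → γ ∈ U → U = ⊤)
    (hδ : ∀ δ : decomp (K := K) 𝔮, (δ : absoluteGaloisGroup K) ∉ κ.kerSubgroup →
      ∀ m : M, ∃ m' : M, δ • m' - m' = m) :
    ∀ δ : decomp (K := K) 𝔮, (δ : absoluteGaloisGroup K) ∉ κ.kerSubgroup →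
      ∀ a : subgroupH1 (Coinv.kerD κ 𝔮) M,
        resH1Hom (Coinv.toKerD κ 𝔮 (kerSubgroup_inf_inertia_le_decomp κ 𝔮) (inf_le_left : κ.kerSubgroup ⊓ inertia 𝔮 ≤ κ.kerSubgroup))
          (AddMonoidHom.id M) (fun _ _ ↦ rfl) a = 0 →
        ∃ ℓ : subgroupH1 (Coinv.kerD κ 𝔮) M,
          resH1Hom (Coinv.toKerD κ 𝔮 (kerSubgroup_inf_inertia_le_decomp κ 𝔮) (inf_le_left : κ.kerSubgroup ⊓ inertia 𝔮 ≤ κ.kerSubgroup))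
            (AddMonoidHom.id M) (fun _ _ ↦ rfl) ℓ = 0 ∧
          conjH1 (Coinv.kerD κ 𝔮) M δ ℓ - ℓ = a := by
  intro δ hδκ a ha
  haveI : CompactSpace (absoluteGaloisGroup K) := absoluteGaloisGroup_compactSpace K
  haveI : CompactSpace (decomp (K := K) 𝔮) := isCompact_iff_compactSpace.mp (Coinv.isClosed_decomp 𝔮).isCompact
  haveI : CompactSpace ↥(Coinv.kerD κ 𝔮) :=
    isCompact_iff_compactSpace.mp (ProcyclicDescent.isClosed_kerK (Coinv.kappaD κ 𝔮)).isCompact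
  have htriv : ∀ (n : ↥(Coinv.kerD κ 𝔮)) (m : M), n • m = m := fun n m ↦
    hD _ (n : decomp (K := K) 𝔮).2 ((Coinv.mem_kerD_iff κ 𝔮 _).1 n.2) m
  -- the inertial elements of `D″`
  let S : Set ↥(Coinv.kerD κ 𝔮) := {x | ((x : decomp (K := K) 𝔮) : absoluteGaloisGroup K) ∈ inertia 𝔮}
  -- `ρ b = 0 ↔` the cocycle of `b` kills `S`
  have hρ : ∀ b : subgroupH1 (Coinv.kerD κ 𝔮) M,
      resH1Hom (Coinv.toKerD κ 𝔮 (kerSubgroup_inf_inertia_le_decomp κ 𝔮)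
          (inf_le_left : κ.kerSubgroup ⊓ inertia 𝔮 ≤ κ.kerSubgroup)) (AddMonoidHom.id M) (fun _ _ ↦ rfl) b = 0 ↔
        ∀ x ∈ S, (cocycleOf _ M htriv b).1 x = 0 := by
    intro b
    constructor
    · intro h x hx
      rw [← oneCocycleClass_cocycleOf htriv b, CocycleCriteria.resH1Hom_oneCocycleClass_eq_zero_iff] at h
      obtain ⟨n, hn⟩ := h
      have hxK : ((x : decomp (K := K) 𝔮) : absoluteGaloisGroup K) ∈ κ.kerSubgroup ⊓ inertia 𝔮 :=
        Subgroup.mem_inf.mpr ⟨(Coinv.mem_kerD_iff κ 𝔮 _).1 x.2, hx⟩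
      have h1 := hn ⟨_, hxK⟩
      have htrivI : (⟨_, hxK⟩ : ↥(κ.kerSubgroup ⊓ inertia 𝔮)) • n = n :=
        hD _ (x : decomp (K := K) 𝔮).2 ((Coinv.mem_kerD_iff κ 𝔮 _).1 x.2) n
      rw [htrivI, sub_self, AddMonoidHom.id_apply] at h1
      have e : Coinv.toKerD κ 𝔮 (kerSubgroup_inf_inertia_le_decomp κ 𝔮)
          (inf_le_left : κ.kerSubgroup ⊓ inertia 𝔮 ≤ κ.kerSubgroup) ⟨_, hxK⟩ = x := Subtype.ext (Subtype.ext rfl)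
      rw [e] at h1
      exact h1
    · intro h
      rw [← oneCocycleClass_cocycleOf htriv b, CocycleCriteria.resH1Hom_oneCocycleClass_eq_zero_iff]
      refine ⟨0, fun x ↦ ?_⟩
      rw [smul_zero, sub_zero, AddMonoidHom.id_apply]
      exact h _ (Subgroup.mem_inf.mp x.2).2
  -- the generator, transported to `↥(Coinv.kerD κ 𝔮)`
  obtain ⟨γ₀, hγ₀⟩ := hγ
  let f : ↥(decomp 𝔮 ⊓ κ.kerSubgroup) →* ↥(Coinv.kerD κ 𝔮) :=
    { toFun := fun x ↦ ⟨⟨(x : absoluteGaloisGroup K), (Subgroup.mem_inf.mp x.2).1⟩,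
        (Coinv.mem_kerD_iff κ 𝔮 _).2 (Subgroup.mem_inf.mp x.2).2⟩
      map_one' := rfl
      map_mul' := fun _ _ ↦ rfl }
  have hfcont : Continuous f := (continuous_subtype_val.subtype_mk _).subtype_mk _
  have hgen : ∀ U : Subgroup ↥(Coinv.kerD κ 𝔮), IsOpen (U : Set ↥(Coinv.kerD κ 𝔮)) → S ⊆ U → f γ₀ ∈ U → U = ⊤ := by
    intro U hU hSU hγU
    have htop : U.comap f = ⊤ := by
      refine hγ₀ (U.comap f) (hU.preimage hfcont) (fun x hx ↦ ?_) hγU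
      rw [Subgroup.mem_comap]
      exact hSU (show f x ∈ S from Subgroup.mem_subgroupOf.mp hx)
    rw [eq_top_iff]
    intro y _
    have hy : (⟨((y : decomp (K := K) 𝔮) : absoluteGaloisGroup K),
        Subgroup.mem_inf.mpr ⟨(y : decomp (K := K) 𝔮).2, (Coinv.mem_kerD_iff κ 𝔮 _).1 y.2⟩⟩ :
          ↥(decomp 𝔮 ⊓ κ.kerSubgroup)) ∈ U.comap f := by
      rw [htop]; exact Subgroup.mem_top _
    rw [Subgroup.mem_comap] at hy
    exact hy
  -- the normalised character `s`
  have hSχ : ∀ x ∈ S, χ.comp (Literature.NumberTheory.EllipticCurves.subgroupIncl (Coinv.kerD κ 𝔮)) x = 1 := fun x hx ↦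
    hχI _ hx ((Coinv.mem_kerD_iff κ 𝔮 _).1 x.2)
  have hex : ∃ d : ↥(Coinv.kerD κ 𝔮), χ.comp (Literature.NumberTheory.EllipticCurves.subgroupIncl (Coinv.kerD κ 𝔮)) d ≠ 1 := by
    obtain ⟨g, hgκ, hg⟩ := hχD
    exact ⟨⟨g, (Coinv.mem_kerD_iff κ 𝔮 g).2 hgκ⟩, hg⟩
  obtain ⟨s, hs, hadd, hS0, hsγ, hsχ⟩ :=
    exists_normalised_additiveChar (Coinv.kerD κ 𝔮) (χ.comp (Literature.NumberTheory.EllipticCurves.subgroupIncl (Coinv.kerD κ 𝔮))) S hSχ (f γ₀) hex hgen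
  have hsδ : ∀ n : ↥(Coinv.kerD κ 𝔮), s (subgroupConj (Coinv.kerD κ 𝔮) δ n) = s n := fun n ↦ hsχ _ _ (by
    change χ ((subgroupConj (Coinv.kerD κ 𝔮) δ n : ↥(Coinv.kerD κ 𝔮)) : decomp (K := K) 𝔮) =
      χ ((n : ↥(Coinv.kerD κ 𝔮)) : decomp (K := K) 𝔮)
    rw [subgroupConj_apply_coe, map_mul, map_mul, map_inv, mul_comm ((χ δ)⁻¹) _, mul_assoc, inv_mul_cancel, mul_one])
  obtain ⟨ℓ, hℓS, hℓ⟩ := exists_conjH1_sub_eq_of_additiveChar (Coinv.kerD κ 𝔮) htriv htor hs hadd S hS0 (f γ₀) hsγ hgen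
    δ hsδ (hδ δ hδκ) a ((hρ a).1 ha)
  exact ⟨ℓ, (hρ ℓ).2 hℓS, hℓ⟩

end Local

end Summit.BirchSwinnertonDyer.BirchSwinnertonDyer.Theorems.PrintCf2.UnrBaseLift

end
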